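import Summits.Ventures.PercRepro.C041TriDomTwoExitDomination

/-!
# ROW C-041 — THEOREM (REDUCTION TO THE HOSTS WITHOUT A CUT AND WITHOUT A TWO-EXIT MARKLESS PIECE), IN THE KERNEL
(p6, gen 46; P6-TWOEXIT-LEAN.md §53 ADDENDUM 17)

THEOREM (REDUCTION) of `C041TriDomGlueInduction` (the induction over the cut vertices, on the number of present
edges) extended by THEOREM (TWO-EXIT MARKLESS PIECE) (`C041TriDomTwoExitDomination`).  A status HAS A TWO-EXIT PIECE
(`HasTwoExit`) if some vertex set `K` off the marks is a two-exit markless piece (`TwoExit`); its two reductions are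
`stDel` (two present edges fewer) and `stCon` (as many present edges, one free edge fewer).  The measure
`muTE st = npres st · (#E + 1) + nfreeE st` drops under every reduction: under the deletion of a side or of the exits
because the number of present edges drops (`μ_lt_of_npres_lt`: the number of free edges is at most `#E`), under the
contraction because the number of present edges stays and the number of free edges drops (`μ_stCon_lt`).
**THEOREM (REDUCTION, TWO-EXIT FORM)** (`cyc_and_sib_of_noCut_noTwoExit`): if CONJECTURE (STOCHASTIC DOMINATION) and
the sibling domination hold, for all marks, on every status without a cut and without a two-exit markless piece, they
hold on every status — in particular on the all-free host (`cycDomination_of_noCut_noTwoExit`).  An unmarked vertex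
of degree two (two free edges to two other vertices, nothing else present) is a two-exit piece
(`hasTwoExit_of_degreeTwo`): the open core is now the hosts without a cut vertex and without an unmarked vertex of
degree `≤ 2` — every subdivision is invisible.
-/

namespace PercRepro

namespace ZoneZ

namespace MultiExit

open ZoneData Finset

variable {V₁ E₁ U₁ U₂ : Type} (Z₁ : ZoneData V₁ E₁ U₁ U₂) (st : E₁ → EStat)

/-! ## Two-exit pieces of a status -/

/-- The status has a two-exit markless piece off the marks `a, b, c`. -/
def HasTwoExit (a b c : V₁) : Prop :=
  ∃ (K : Set V₁) (u v : V₁) (f₁ f₂ : E₁), TwoExit Z₁ st K u v f₁ f₂ ∧ a ∉ K ∧ b ∉ K ∧ c ∉ K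

/-- An unmarked vertex `w` of degree two — two free edges `f₁ = w–u`, `f₂ = w–v` to other vertices and no other
present edge at `w` — is a two-exit markless piece `{w}`. -/
theorem hasTwoExit_of_degreeTwo {a b c w u v : V₁} {f₁ f₂ : E₁} (hwa : w ≠ a) (hwb : w ≠ b) (hwc : w ≠ c)
    (hu : u ≠ w) (hv : v ≠ w) (hne : f₁ ≠ f₂) (hs₁ : st f₁ = EStat.free) (hs₂ : st f₂ = EStat.free)
    (hj₁ : Z₁.Joins f₁ w u) (hj₂ : Z₁.Joins f₂ w v)
    (hdeg : ∀ e, presE st e → Z₁.Touches {w} e → e = f₁ ∨ e = f₂) : HasTwoExit Z₁ st a b c := by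
  refine ⟨{w}, u, v, f₁, f₂, ⟨hu, hv, hne, hs₁, hs₂, ⟨w, rfl, hj₁⟩, ⟨w, rfl, hj₂⟩, ?_⟩, ?_, ?_, ?_⟩
  · intro e he ht
    rcases hdeg e he ht with h | h
    · exact Or.inl h
    · exact Or.inr (Or.inl h)
  · exact fun h => hwa (Set.mem_singleton_iff.mp h).symm
  · exact fun h => hwb (Set.mem_singleton_iff.mp h).symm
  · exact fun h => hwc (Set.mem_singleton_iff.mp h).symm

variable [DecidableEq E₁]

/-- A present edge of `stDel` is a present edge of `st` other than the exits. -/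
theorem presE_stDel {st : E₁ → EStat} {f₁ f₂ e : E₁} (h : presE (stDel st f₁ f₂) e) : presE st e ∧ ¬ (e = f₁ ∨ e = f₂) := by
  unfold presE stDel at h
  by_cases he : e = f₁ ∨ e = f₂
  · rw [if_pos he] at h
    exact absurd rfl h
  · rw [if_neg he] at h
    exact ⟨h, he⟩

/-! ## The measure -/

section Measure

variable [Fintype E₁]

open Classical in
/-- The number of free edges of a status. -/
noncomputable def nfreeE : ℕ := (univ.filter fun e => st e = EStat.free).card

open Classical in
/-- The measure of the induction: present edges first, then free edges. -/
noncomputable def muTE : ℕ := npres st * (Fintype.card E₁ + 1) + nfreeE st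

omit [DecidableEq E₁] in
open Classical in
/-- There are at most `#E` free edges. -/
theorem nfreeE_le : nfreeE st ≤ Fintype.card E₁ := by
  unfold nfreeE
  exact (Finset.card_filter_le _ _).trans (le_of_eq (Finset.card_univ))

omit [DecidableEq E₁] in
open Classical in
/-- The measure drops when the number of present edges drops. -/
theorem μ_lt_of_npres_lt {st' : E₁ → EStat} (h : npres st' < npres st) : muTE st' < muTE st := by
  unfold muTE
  have h1 := nfreeE_le st'
  have h2 : npres st' + 1 ≤ npres st := h
  calc npres st' * (Fintype.card E₁ + 1) + nfreeE st' ≤ npres st' * (Fintype.card E₁ + 1) + Fintype.card E₁ := by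
        omega
    _ < (npres st' + 1) * (Fintype.card E₁ + 1) := by ring_nf; omega
    _ ≤ npres st * (Fintype.card E₁ + 1) := Nat.mul_le_mul_right _ h2
    _ ≤ npres st * (Fintype.card E₁ + 1) + nfreeE st := Nat.le_add_right _ _

variable {st}

open Classical in
/-- Deleting the exits lowers the number of present edges. -/
theorem npres_stDel_lt {K : Set V₁} {u v : V₁} {f₁ f₂ : E₁} (hT : TwoExit Z₁ st K u v f₁ f₂) :
    npres (stDel st f₁ f₂) < npres st := by
  unfold npres
  apply Finset.card_lt_card
  rw [Finset.ssubset_iff_subset_ne]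
  constructor
  · intro e he
    rw [Finset.mem_filter] at he ⊢
    exact ⟨Finset.mem_univ _, (presE_stDel he.2).1⟩
  · intro heq
    have hp : f₁ ∈ univ.filter fun e => presE st e := by
      rw [Finset.mem_filter]
      refine ⟨Finset.mem_univ _, ?_⟩
      unfold presE
      rw [hT.hs₁]
      decide
    rw [← heq, Finset.mem_filter] at hp
    exact (presE_stDel hp.2).2 (Or.inl rfl)

open Classical in
/-- Contracting a free exit keeps the number of present edges. -/
theorem npres_stCon_eq {f₁ : E₁} (hs₁ : st f₁ = EStat.free) : npres (stCon st f₁) = npres st := by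
  unfold npres
  congr 1
  ext e
  simp only [Finset.mem_filter, Finset.mem_univ, true_and]
  unfold presE stCon
  by_cases he : e = f₁
  · rw [if_pos he, he, hs₁]
    decide
  · rw [if_neg he]

open Classical in
/-- Contracting a free exit lowers the number of free edges. -/
theorem nfreeE_stCon_lt {f₁ : E₁} (hs₁ : st f₁ = EStat.free) : nfreeE (stCon st f₁) < nfreeE st := by
  unfold nfreeE
  apply Finset.card_lt_card
  rw [Finset.ssubset_iff_subset_ne]
  constructor
  · intro e he
    rw [Finset.mem_filter] at he ⊢
    refine ⟨Finset.mem_univ _, ?_⟩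
    unfold stCon at he
    by_cases hef : e = f₁
    · rw [if_pos hef] at he
      exact absurd he.2 (by decide)
    · rw [if_neg hef] at he
      exact he.2
  · intro heq
    have hp : f₁ ∈ univ.filter fun e => st e = EStat.free := by
      rw [Finset.mem_filter]
      exact ⟨Finset.mem_univ _, hs₁⟩
    rw [← heq, Finset.mem_filter] at hp
    unfold stCon at hp
    rw [if_pos rfl] at hp
    exact absurd hp.2 (by decide)

open Classical in
/-- The measure drops under the deletion of the exits. -/
theorem μ_stDel_lt {K : Set V₁} {u v : V₁} {f₁ f₂ : E₁} (hT : TwoExit Z₁ st K u v f₁ f₂) :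
    muTE (stDel st f₁ f₂) < muTE st :=
  μ_lt_of_npres_lt st (npres_stDel_lt Z₁ hT)

open Classical in
/-- The measure drops under the contraction of a free exit. -/
theorem μ_stCon_lt {f₁ : E₁} (hs₁ : st f₁ = EStat.free) : muTE (stCon st f₁) < muTE st := by
  unfold muTE
  rw [npres_stCon_eq hs₁]
  exact Nat.add_lt_add_left (nfreeE_stCon_lt hs₁) _

end Measure

/-! ## The reduction -/

section Induction

variable [Fintype E₁]

open Classical in
/-- The induction step at a status with a two-exit markless piece. -/
theorem step_of_hasTwoExit (a b c : V₁) (h2 : HasTwoExit Z₁ st a b c)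
    (ih : ∀ st' : E₁ → EStat, muTE st' < muTE st → ∀ a' b' c' : V₁,
      CycDominationS Z₁ a' b' c' st' ∧ SibDominationS Z₁ a' b' c' st') :
    CycDominationS Z₁ a b c st ∧ SibDominationS Z₁ a b c st := by
  obtain ⟨K, u, v, f₁, f₂, hT, ha, hb, hc⟩ := h2
  have IH₀ := ih (stDel st f₁ f₂) (μ_stDel_lt Z₁ hT) a b c
  have IH₁ := ih (stCon st f₁) (μ_stCon_lt hT.hs₁) a b c
  exact ⟨cycDominationS_of_twoExit Z₁ hT a b c ha hb hc IH₀.1 IH₁.1,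
    sibDominationS_of_twoExit Z₁ hT a b c ha hb hc IH₀.2 IH₁.2⟩

open Classical in
/-- **THEOREM (REDUCTION, TWO-EXIT FORM)**: if the conjecture and the sibling domination hold, for all marks, on
every status without a cut and without a two-exit markless piece, they hold on every status. -/
theorem cyc_and_sib_of_noCut_noTwoExit
    (hbase : ∀ st : E₁ → EStat, ∀ a b c : V₁, ¬ HasCut Z₁ st a b c → ¬ HasTwoExit Z₁ st a b c →
      CycDominationS Z₁ a b c st ∧ SibDominationS Z₁ a b c st) :
    ∀ st : E₁ → EStat, ∀ a b c : V₁, CycDominationS Z₁ a b c st ∧ SibDominationS Z₁ a b c st := by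
  intro st
  suffices h : ∀ n : ℕ, ∀ st : E₁ → EStat, muTE st = n → ∀ a b c : V₁,
      CycDominationS Z₁ a b c st ∧ SibDominationS Z₁ a b c st from h _ st rfl
  intro n
  induction n using Nat.strong_induction_on with
  | _ n ih =>
    intro st hst a b c
    by_cases hcut : HasCut Z₁ st a b c
    · exact step_of_hasCut Z₁ st a b c hcut fun st' hlt =>
        ih (muTE st') (hst ▸ μ_lt_of_npres_lt st hlt) st' rfl
    · by_cases h2 : HasTwoExit Z₁ st a b c
      · exact step_of_hasTwoExit Z₁ st a b c h2 fun st' hlt => ih (muTE st') (hst ▸ hlt) st' rfl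
      · exact hbase st a b c hcut h2

open Classical in
/-- CONJECTURE (STOCHASTIC DOMINATION) on the all-free host, from the statuses without a cut and without a two-exit
markless piece. -/
theorem cycDomination_of_noCut_noTwoExit
    (hbase : ∀ st : E₁ → EStat, ∀ a b c : V₁, ¬ HasCut Z₁ st a b c → ¬ HasTwoExit Z₁ st a b c →
      CycDominationS Z₁ a b c st ∧ SibDominationS Z₁ a b c st) (x y z : V₁) :
    CycDomination Z₁ x y z :=
  (cyc_and_sib_of_noCut_noTwoExit Z₁ hbase (fun _ => EStat.free) x y z).1

end Induction

end MultiExit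

end ZoneZ

end PercRepro
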